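import Mathlib
import Literature.NumberTheory.LFunctions.Zhang2022.RepairBedEndgame
import Literature.NumberTheory.LFunctions.Zhang2022.RepairBandMeanValue
import HarnessLib

/-!
# Zhang (2022), rescue bed (D-0124 (3)) Tier S add-ons: profile / general-coefficient Dirichlet-polynomial BLOCKS
# over an explicit Scale, their 2×2 Gram entries and abs-weighted discrete means (bed node group 3: N3-C «LENX»,
# N3-D «E108»), with regression to the tree at Zhang's scale

Topic `Literature/NumberTheory/LFunctions/Zhang2022` (Landau–Siegel audit tree; verdict-neutral).
Y. Zhang, *Discrete mean estimates and the Landau–Siegel zero*, arXiv:2211.02515v1 (2022)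
[Zhang2022LandauSiegel] — **an unrefereed manuscript under adjudication; nothing in this file asserts or
denies any of its claims, and nothing here is a claim about Landau–Siegel zeros.**

Purpose. The length edge (`E*-len`, registry E-001/E-002: `KnifeEdge.twoPieceMainTerm θ X`) and the band seam
(E-108: `Repair.BandMeanValue c′ m κ`) are priced at MAIN ORDER by functionals of a profile `g` (tree:
`Repair.profPoly`, `Repair.coefBlock`, `Repair.coefBlockMean`, `Repair.discWeight`, all at Zhang's scale through
`x : Skeleton.Chr D` and `P = exp 𝓛⁹`). The bed's Tier-S add-ons (rescue/BED.md G2-04 → bed-3 node N3-C «LENX»;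
G2-02 → N3-D «E108») evaluate the same finite objects at an explicit `Scale` (`RepairBedScale.Scale`) over an explicit
character `ψ (mod p)` and an explicit zero set: the overhang polynomial `H_v(ρ,ψ) = Σ_{P ≤ n < P^θ} χψ(n)v(ln n/ln P)n^{−ρ}`,
the 2×2 blocks `Σ_ρ Re 𝔠*·Re ω·(H_u, H_v)ᵀ(H̄_u, H̄_v)`, and the abs-weighted Gram/Rayleigh data of a coefficient block.
This file gives them typed referents:

* `profCoefS S g n = g(log n / log S.P)` (regression `profCoefS_zhang : profCoefS (Scale.zhang D) = Repair.profCoef D`);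
* `coefBlockB χ ψ a M N s = Σ_{M ≤ n < N} ψχ(n)·a(n)·n^{−s}` for an ARBITRARY `ψ (mod p)` (regression `coefBlockB_zhang :
  … = Repair.coefBlock χ x a M N s`), `profBlockB S χ ψ g M N s` (profile coefficients; = `KnifeEdge.blockPoly` at Zhang's
  scale), `profPolyB` (`= Repair.profPoly`);
* the named N3-C profiles `archProfile θ x = (x−1)(θ−x)`, `jumpProfile θ x = 1_{(1,θ]}(x)·(θ−x)` (real, as `ℂ`-valued);
* the per-zero Gram entry `gramTerm S ψ c' A B ρ = Re 𝔠*·(A ρ·conj(B ρ))·Re ω` for two block maps `A, B : ℂ → ℂ`, its sum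
  `gramSum`, and the abs-weighted versions `coefBlockMeanB` / `discWeightB` over an explicit zero set (regressions to
  `Repair.coefBlockMean` / `Repair.discWeight` as sums over `Skeleton.idx χ`);
* sign-free kernel facts a bed row can check: `gramTerm_self_re` (the diagonal entry is `Re 𝔠*·‖A ρ‖²·Re ω`, real),
  `gramTerm_swap` (Hermitian symmetry `gram(B,A) = conj gram(A,B)` when `𝔠*`, `ω` are real), `coefBlockMeanB_nonneg`,
  and the Rayleigh bound shape used by N3-D is left to the engines (eigenvalues are not typed here).

Pure definitions, `rfl`-regressions and three lines of algebra; no analytic content; no `instance`, no notation.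

## References

* Y. Zhang, arXiv:2211.02515v1 (2022), §2 (2.16), (2.23), (2.30); §7 Prop 7.1, (7.2) p.44.
  [cite: Zhang2022LandauSiegel, §§2, 7]
-/

noncomputable section

open Complex Real ComplexConjugate

namespace Literature.NumberTheory.LFunctions.Zhang2022.Repair.Bed

section Blocks

variable (S : Scale) {D : ℕ} (χ : DirichletCharacter ℂ D) {p : ℕ} (ψ : DirichletCharacter ℂ p)

/-- The coefficient sequence of a profile `g` at scale `S`: `a(n) = g(log n / log P)` (tree: `Repair.profCoef D g` at
Zhang's scale). [cite: Zhang2022LandauSiegel, §2 (2.23); §7 (7.2) p.44] -/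
def profCoefS (g : ℝ → ℂ) (n : ℕ) : ℂ := g (Real.log n / Real.log S.P)

/-- **A Dirichlet-polynomial block with GENERAL coefficients**, twisted by `ψχ`, for an arbitrary `ψ (mod p)`:
`B(a; M, N; ψ, s) = Σ_{M ≤ n < N} ψχ(n)·a(n)·n^{−s}` (tree: `Repair.coefBlock` for a member of `Ψ`).
[cite: Zhang2022LandauSiegel, §2 (2.23); §7 (7.2) p.44] -/
def coefBlockB (a : ℕ → ℂ) (M N : ℕ) (s : ℂ) : ℂ := ∑ n ∈ Finset.Ico M N, pc χ ψ n * a n * (n : ℂ) ^ (-s)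

/-- The profile block at scale `S`: `Σ_{M ≤ n < N} ψχ(n)·g(log n/log P)·n^{−s}` — the N3-C overhang polynomial
`H_v(ρ,ψ)` is `profBlockB S χ ψ v ⌈P⌉ ⌈P^θ⌉ ρ`. [cite: Zhang2022LandauSiegel, §2 (2.23), (2.30)] -/
def profBlockB (g : ℝ → ℂ) (M N : ℕ) (s : ℂ) : ℂ := coefBlockB χ ψ (profCoefS S g) M N s

/-- The profile polynomial of length `N` at scale `S`: `Σ_{1 ≤ n < N} ψχ(n)·g(log n/log P)·n^{−s}` (tree:
`Repair.profPoly`). [cite: Zhang2022LandauSiegel, §2 (2.23); §7 (7.2) p.44] -/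
def profPolyB (g : ℝ → ℂ) (N : ℕ) (s : ℂ) : ℂ := profBlockB S χ ψ g 1 N s

/-- The N3-C «arch» overhang profile on `[1, θ]`: `v_A(x) = (x − 1)(θ − x)` (`v(1) = v(θ) = 0`).
[cite: Zhang2022LandauSiegel, §7 (7.2) p.44] -/
def archProfile (θ : ℝ) (x : ℝ) : ℂ := (((x - 1) * (θ - x) : ℝ) : ℂ)

/-- The N3-C «jump at the wall» overhang profile: `v_J(x) = 1_{(1,θ]}(x)·(θ − x)` (the non-smooth class of the rescue's
REQSIDE U-a). [cite: Zhang2022LandauSiegel, §7 (7.2) p.44] -/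
def jumpProfile (θ : ℝ) (x : ℝ) : ℂ := if 1 < x ∧ x ≤ θ then (((θ - x) : ℝ) : ℂ) else 0

variable [NeZero p]

/-- **The per-zero Gram entry** of two block maps `A, B : ℂ → ℂ` (values of two Dirichlet polynomials at the zero):
`Re 𝔠*(ρ,ψ)·(A(ρ)·conj(B(ρ)))·Re ω(ρ)` — the `(A,B)` entry of the bed's 2×2 block matrix `𝕄` (N3-C), unnormalised.
[cite: Zhang2022LandauSiegel, §2 (2.16); §7 (7.2) p.44] -/
def gramTerm (c' : ℝ) (A B : ℂ → ℂ) (ρ : ℂ) : ℂ :=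
  ((cstar S ψ c' ρ).re : ℂ) * (A ρ * conj (B ρ)) * ((omegaW S ρ).re : ℂ)

/-- The Gram entry summed over an explicit finite zero set. [cite: Zhang2022LandauSiegel, §2 (2.16)] -/
def gramSum (c' : ℝ) (A B : ℂ → ℂ) (Z : Finset ℂ) : ℂ := ∑ ρ ∈ Z, gramTerm S ψ c' A B ρ

/-- **The abs-weighted discrete mean of a coefficient block** over an explicit zero set:
`Σ_{ρ ∈ Z} |Re 𝔠*·Re ω|·|B(a; M, N; ψ, ρ)|²` (tree: `Repair.coefBlockMean`, the E-108 slot's left side; N3-D's Rayleigh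
numerator for the coefficient direction `a`). [cite: Zhang2022LandauSiegel, §2 (2.16)–(2.20)] -/
def coefBlockMeanB (c' : ℝ) (a : ℕ → ℂ) (M N : ℕ) (Z : Finset ℂ) : ℝ :=
  ∑ ρ ∈ Z, |(cstar S ψ c' ρ).re * (omegaW S ρ).re| * ‖coefBlockB χ ψ a M N ρ‖ ^ 2

/-- **The total absolute weight** `Σ_{ρ ∈ Z} |Re 𝔠*(ρ,ψ)·Re ω(ρ)|` over an explicit zero set (tree: `Repair.discWeight`;
N3-D's `W`). [cite: Zhang2022LandauSiegel, §2 (2.15)–(2.16)] -/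
def discWeightB (c' : ℝ) (Z : Finset ℂ) : ℝ := ∑ ρ ∈ Z, |(cstar S ψ c' ρ).re * (omegaW S ρ).re|

/-! ### Sign-free kernel facts for bed rows -/

variable {S ψ}

/-- The diagonal Gram entry is real and equals `Re 𝔠*·‖A ρ‖²·Re ω`. [cite: Zhang2022LandauSiegel, §2 (2.16)] -/
theorem gramTerm_self (c' : ℝ) (A : ℂ → ℂ) (ρ : ℂ) :
    gramTerm S ψ c' A A ρ = (((cstar S ψ c' ρ).re * ‖A ρ‖ ^ 2 * (omegaW S ρ).re : ℝ) : ℂ) := by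
  unfold gramTerm
  rw [Complex.mul_conj, Complex.normSq_eq_norm_sq]
  push_cast
  ring

/-- Hermitian symmetry of the Gram entries: `gram(B, A) = conj (gram(A, B))` (the weights are real).
[cite: Zhang2022LandauSiegel, §2 (2.16)] -/
theorem gramTerm_swap (c' : ℝ) (A B : ℂ → ℂ) (ρ : ℂ) :
    gramTerm S ψ c' B A ρ = conj (gramTerm S ψ c' A B ρ) := by
  unfold gramTerm
  simp only [map_mul, Complex.conj_ofReal, Complex.conj_conj]
  ring

/-- `coefBlockMeanB ≥ 0` and `discWeightB ≥ 0` (absolute weights). [cite: Zhang2022LandauSiegel, §2 (2.16)] -/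
theorem coefBlockMeanB_nonneg (c' : ℝ) (a : ℕ → ℂ) (M N : ℕ) (Z : Finset ℂ) :
    0 ≤ coefBlockMeanB S χ ψ c' a M N Z ∧ 0 ≤ discWeightB S ψ c' Z :=
  ⟨Finset.sum_nonneg fun _ _ => mul_nonneg (abs_nonneg _) (sq_nonneg _),
   Finset.sum_nonneg fun _ _ => abs_nonneg _⟩

end Blocks

/-! ## Regression at Zhang's scale -/

section Regression

variable (c' : ℝ) (D : ℕ) (χ : DirichletCharacter ℂ D) (x : Skeleton.Chr D)

/-- Profile coefficients at Zhang's scale are the tree's `Repair.profCoef`. [cite: Zhang2022LandauSiegel, §2 (2.23)] -/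
theorem profCoefS_zhang (g : ℝ → ℂ) : profCoefS (Scale.zhang D) g = Repair.profCoef D g := rfl

/-- The general-coefficient block for a member of `Ψ` is the tree's `Repair.coefBlock`. [cite: Zhang2022LandauSiegel, §2 (2.23)] -/
theorem coefBlockB_zhang (a : ℕ → ℂ) (M N : ℕ) (s : ℂ) :
    coefBlockB χ x.ψ a M N s = Repair.coefBlock χ x a M N s := rfl

/-- The profile block at Zhang's scale is the tree's `KnifeEdge.blockPoly`. [cite: Zhang2022LandauSiegel, §2 (2.23), (2.30)] -/
theorem profBlockB_zhang (g : ℝ → ℂ) (M N : ℕ) (s : ℂ) :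
    profBlockB (Scale.zhang D) χ x.ψ g M N s = KnifeEdge.blockPoly χ x M N g s := rfl

/-- The profile polynomial at Zhang's scale is the tree's `Repair.profPoly`. [cite: Zhang2022LandauSiegel, §2 (2.23)] -/
theorem profPolyB_zhang (g : ℝ → ℂ) (N : ℕ) (s : ℂ) :
    profPolyB (Scale.zhang D) χ x.ψ g N s = Repair.profPoly χ x g N s := rfl

/-- `Repair.coefBlockMean` is the sum over the skeleton's family of the bed's per-character abs-weighted block means
over the zero boxes. [cite: Zhang2022LandauSiegel, §2 (2.16)–(2.20)] -/
theorem coefBlockMean_eq_sum (a : ℕ → ℂ) (M N : ℕ) :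
    Repair.coefBlockMean c' χ a M N = ∑ y ∈ Skeleton.finsetOf (Skeleton.PsiOne χ),
      coefBlockMeanB (Scale.zhang D) χ y.ψ c' a M N (Skeleton.finsetOf (Skeleton.zeroSet D y)) := by
  rw [Repair.coefBlockMean, Skeleton.idx, Finset.sum_sigma]
  rfl

/-- `Repair.discWeight` is the sum over the family of the bed's per-character total absolute weights.
[cite: Zhang2022LandauSiegel, §2 (2.15)–(2.16)] -/
theorem discWeight_eq_sum :
    Repair.discWeight c' χ = ∑ y ∈ Skeleton.finsetOf (Skeleton.PsiOne χ),
      discWeightB (Scale.zhang D) y.ψ c' (Skeleton.finsetOf (Skeleton.zeroSet D y)) := by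
  rw [Repair.discWeight, Skeleton.idx, Finset.sum_sigma]
  rfl

/-- The bed's `xi11Term` is the diagonal Gram entry of `H₁` (real part): `xi11Term = Re (gramTerm H₁ H₁)`.
[cite: Zhang2022LandauSiegel, §8 (8.3)] -/
theorem xi11Term_eq_gramTerm_re (S : Scale) {p : ℕ} [NeZero p] (ψ : DirichletCharacter ℂ p) (ρ : ℂ) :
    xi11Term S χ ψ c' ρ = (gramTerm S ψ c' (H1 S χ ψ) (H1 S χ ψ) ρ).re := by
  rw [gramTerm_self, Complex.ofReal_re]
  rfl

end Regression

end Literature.NumberTheory.LFunctions.Zhang2022.Repair.Bed
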